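import Literature.NumberTheory.LFunctions.TauberianTheorems
import Literature.NumberTheory.LFunctions.Tauberian
import Literature.NumberTheory.LFunctions.WienerIkeharaLaplace
import Mathlib.NumberTheory.LSeries.SumCoeff
import Mathlib.MeasureTheory.Function.JacobianOneDim
import Mathlib.Analysis.SpecialFunctions.ImproperIntegrals
import HarnessLib

/-!
# Discharge of `Literature.NumberTheory.LFunctions.WienerIkehara` (Montgomery–Vaughan 2007, Cor. 8.8)

D-0014 states cited results in `Literature/` as named facts `def X : Prop` (no unproved declarations).
This sibling file of `Literature.NumberTheory.LFunctions.TauberianTheorems` proves the named fact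
`Literature.NumberTheory.LFunctions.WienerIkehara` (the Wiener–Ikehara Tauberian theorem for Dirichlet series with non-negative
coefficients) as `Literature.WienerIkehara_holds : Literature.WienerIkehara`; users holding
`(h : Literature.WienerIkehara)` are fed `Literature.NumberTheory.LFunctions.WienerIkehara_holds`. (The other named fact of that file,
`Literature.NumberTheory.LFunctions.HardyLittlewoodTauberianDirichlet`, is the subject of `TauberianTheoremsProofs`.) The verbatim
duplicate `Literature.NumberTheory.LFunctions.MontgomeryVaughan2007_8_8` of `Literature.NumberTheory.LFunctions.Tauberian`
is discharged by the same term (`Literature.NumberTheory.LFunctions.MontgomeryVaughan2007_8_8_holds`).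

## Proof

The classical Ikehara–Bochner–Landau proof, in four files:
`WienerIkeharaKernel` (Fejér kernel and its Fourier identity), `WienerIkeharaTauberian`
(Fejér means + monotonicity ⇒ convergence), `WienerIkeharaLaplace` (Fubini, `ε → 0⁺`,
Riemann–Lebesgue; Laplace-transform form `tendsto_of_laplace`), and this file, which performs the
reduction of Cor. 8.8 to the Laplace form (Montgomery–Vaughan's Cor. 8.7 ⇒ Cor. 8.8 ⇒ Thm. 8.6
changes of variables): with `A(x) = ∑_{n ≤ x} a_n` and `B(u) = e^{-u} A(e^u)` (`u > 0`),

* `A` is non-decreasing, `A(x) ≤ x^σ ∑ a_n n^{-σ}` (`σ > 1`), so `B(u) ≤ C_ε e^{εu}` and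
  `B(v) ≥ e^{u-v} B(u)` (`u ≤ v`);
* `∑ a_n n^{-s} = s ∫_1^∞ A(t) t^{-s-1} dt = s ∫_0^∞ B(u) e^{-(s-1)u} du` for `Re s > 1`
  (Mathlib's `LSeries_eq_mul_integral_of_nonneg` and the substitution `t = e^u`);
* hence `G(s) := (r(s) − c)/s = ∫_0^∞ (B(u) − c) e^{-(s−1)u} du` on `Re s > 1`, and `G` is
  continuous on `Re s ≥ 1` when `r` is;
* `tendsto_of_laplace` gives `B(u) → c`, i.e. `A(N)/N = B(log N) → c`, i.e.
  `∑_{n ≤ N} a_n − cN = o(N)`.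

## References

* H. L. Montgomery, R. C. Vaughan, *Multiplicative Number Theory I. Classical Theory*, Cambridge
  Stud. Adv. Math. 97, CUP 2007, §8.3: Thm. 8.6, Cor. 8.7, **Cor. 8.8** (book p. 261).
* K. Chandrasekharan, *Introduction to Analytic Number Theory*, Grundlehren 148, Springer 1968,
  Ch. XI §2.
-/

noncomputable section

open Real MeasureTheory Filter Set Complex Finset Asymptotics
open scoped Topology

namespace Literature.NumberTheory.LFunctions.WienerIkehara

/-! ## The summatory function `A(x) = ∑_{n ≤ x} a_n` -/

/-- `A(x) = ∑_{1 ≤ n ≤ ⌊x⌋} a_n` is non-decreasing when `a_n ≥ 0`. [folklore] -/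
theorem monotone_summatory {a : ℕ → ℝ} (ha : ∀ n, 0 ≤ a n) :
    Monotone fun x : ℝ => ∑ n ∈ Icc 1 ⌊x⌋₊, a n := by
  intro x y hxy
  refine sum_le_sum_of_subset_of_nonneg (Icc_subset_Icc_right (Nat.floor_le_floor hxy))
    fun n _ _ => ha n

/-- `A(x) ≥ 0` when `a_n ≥ 0`. [folklore] -/
theorem summatory_nonneg {a : ℕ → ℝ} (ha : ∀ n, 0 ≤ a n) (x : ℝ) :
    0 ≤ ∑ n ∈ Icc 1 ⌊x⌋₊, a n :=
  sum_nonneg fun n _ => ha n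

/-- Convergence of the Dirichlet series at real `σ` in real terms: if `∑ a_n n^{-s}` is
`LSeriesSummable` at `s = σ ∈ ℝ`, then `n ↦ a_n / n^σ` (with `0 ↦ 0`) is summable. [folklore] -/
theorem summable_real_of_LSeriesSummable {a : ℕ → ℝ} {σ : ℝ}
    (h : LSeriesSummable (fun n => (a n : ℂ)) σ) :
    Summable fun n : ℕ => if n = 0 then 0 else a n / (n : ℝ) ^ σ := by
  rw [← Complex.summable_ofReal]
  refine h.congr fun n => ?_
  rcases eq_or_ne n 0 with rfl | hn
  · simp
  · rw [LSeries.term_of_ne_zero hn, if_neg hn]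
    push_cast
    rw [Complex.ofReal_cpow (Nat.cast_nonneg n)]
    norm_cast

/-- **Partial sums vs. the Dirichlet series** (`a_n ≥ 0`, `σ > 0`, `x ≥ 0`):
`∑_{n ≤ x} a_n ≤ x^σ ∑_{n ≥ 1} a_n n^{-σ}`. [folklore] -/
theorem summatory_le_rpow_mul_tsum {a : ℕ → ℝ} (ha : ∀ n, 0 ≤ a n) {σ : ℝ} (hσ : 0 < σ)
    (hs : Summable fun n : ℕ => if n = 0 then 0 else a n / (n : ℝ) ^ σ) {x : ℝ} (hx : 0 ≤ x) :
    ∑ n ∈ Icc 1 ⌊x⌋₊, a n ≤ x ^ σ * ∑' n : ℕ, (if n = 0 then 0 else a n / (n : ℝ) ^ σ) := by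
  have hg0 : ∀ n : ℕ, 0 ≤ (if n = 0 then 0 else a n / (n : ℝ) ^ σ) := fun n => by
    split_ifs
    · exact le_rfl
    · exact div_nonneg (ha n) (by positivity)
  calc ∑ n ∈ Icc 1 ⌊x⌋₊, a n
      ≤ ∑ n ∈ Icc 1 ⌊x⌋₊, x ^ σ * (if n = 0 then 0 else a n / (n : ℝ) ^ σ) := by
        refine sum_le_sum fun n hn => ?_
        rw [Finset.mem_Icc] at hn
        have hn0 : n ≠ 0 := by omega
        have hnx : (n : ℝ) ≤ x := (Nat.floor_le hx).trans' (by exact_mod_cast hn.2)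
        have hnpos : 0 < (n : ℝ) ^ σ := by positivity
        rw [if_neg hn0, mul_div_assoc', le_div_iff₀ hnpos]
        rw [mul_comm]
        gcongr
        exact ha n
    _ = x ^ σ * ∑ n ∈ Icc 1 ⌊x⌋₊, (if n = 0 then 0 else a n / (n : ℝ) ^ σ) := by
        rw [mul_sum]
    _ ≤ x ^ σ * ∑' n : ℕ, (if n = 0 then 0 else a n / (n : ℝ) ^ σ) := by
        gcongr
        exact hs.sum_le_tsum _ (fun n _ => hg0 n)

/-! ## The normalised summatory function `B(u) = e^{-u} A(e^u)` (`u > 0`) -/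

/-- `B(u) = e^{-u} A(e^u)` for `u > 0` and `B(u) = 0` for `u ≤ 0`. Written as an indicator so
that no new definition is introduced; this abbreviation is local to the proofs below. [folklore] -/
theorem normSummatory_apply_of_pos {a : ℕ → ℝ} {u : ℝ} (hu : 0 < u) :
    (Ioi (0 : ℝ)).indicator (fun u => (∑ n ∈ Icc 1 ⌊rexp u⌋₊, a n) * rexp (-u)) u
      = (∑ n ∈ Icc 1 ⌊rexp u⌋₊, a n) * rexp (-u) :=
  indicator_of_mem hu _

/-- `B(u) = 0` for `u ≤ 0`. [folklore] -/
theorem normSummatory_apply_of_nonpos {a : ℕ → ℝ} {u : ℝ} (hu : u ≤ 0) :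
    (Ioi (0 : ℝ)).indicator (fun u => (∑ n ∈ Icc 1 ⌊rexp u⌋₊, a n) * rexp (-u)) u = 0 :=
  indicator_of_notMem (by simpa using hu) _

/-- `B` is measurable (`A ∘ exp` is monotone). [folklore] -/
theorem measurable_normSummatory {a : ℕ → ℝ} (ha : ∀ n, 0 ≤ a n) :
    Measurable ((Ioi (0 : ℝ)).indicator (fun u => (∑ n ∈ Icc 1 ⌊rexp u⌋₊, a n) * rexp (-u))) := by
  refine Measurable.indicator ?_ measurableSet_Ioi
  refine Measurable.mul ?_ (by fun_prop)
  exact ((monotone_summatory ha).comp Real.exp_monotone).measurable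

/-- `B ≥ 0`. [folklore] -/
theorem normSummatory_nonneg {a : ℕ → ℝ} (ha : ∀ n, 0 ≤ a n) (u : ℝ) :
    0 ≤ (Ioi (0 : ℝ)).indicator (fun u => (∑ n ∈ Icc 1 ⌊rexp u⌋₊, a n) * rexp (-u)) u := by
  by_cases hu : 0 < u
  · rw [normSummatory_apply_of_pos hu]
    exact mul_nonneg (summatory_nonneg ha _) (exp_pos _).le
  · rw [normSummatory_apply_of_nonpos (not_lt.1 hu)]

/-- Slow decrease: `B(v) ≥ e^{u−v} B(u)` for `u ≤ v` (because `A` is non-decreasing). [folklore] -/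
theorem normSummatory_slowly_decreasing {a : ℕ → ℝ} (ha : ∀ n, 0 ≤ a n) (u v : ℝ) (huv : u ≤ v) :
    (Ioi (0 : ℝ)).indicator (fun u => (∑ n ∈ Icc 1 ⌊rexp u⌋₊, a n) * rexp (-u)) u * rexp (u - v)
      ≤ (Ioi (0 : ℝ)).indicator (fun u => (∑ n ∈ Icc 1 ⌊rexp u⌋₊, a n) * rexp (-u)) v := by
  by_cases hu : 0 < u
  · have hv : 0 < v := hu.trans_le huv
    rw [normSummatory_apply_of_pos hu, normSummatory_apply_of_pos hv, mul_assoc, ← Real.exp_add,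
      show -u + (u - v) = -v by ring]
    exact mul_le_mul_of_nonneg_right (monotone_summatory ha (exp_le_exp.2 huv)) (exp_pos _).le
  · rw [normSummatory_apply_of_nonpos (not_lt.1 hu), zero_mul]
    exact normSummatory_nonneg ha v

/-- Growth: if `∑ a_n n^{-σ}` converges (`σ > 1`) then `B(u) ≤ (∑ a_n n^{-σ}) e^{(σ−1)u}`.
[folklore] -/
theorem normSummatory_le {a : ℕ → ℝ} (ha : ∀ n, 0 ≤ a n) {σ : ℝ} (hσ : 1 < σ)
    (hs : Summable fun n : ℕ => if n = 0 then 0 else a n / (n : ℝ) ^ σ) (u : ℝ) :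
    (Ioi (0 : ℝ)).indicator (fun u => (∑ n ∈ Icc 1 ⌊rexp u⌋₊, a n) * rexp (-u)) u
      ≤ (∑' n : ℕ, (if n = 0 then 0 else a n / (n : ℝ) ^ σ)) * rexp ((σ - 1) * u) := by
  have hS : 0 ≤ ∑' n : ℕ, (if n = 0 then 0 else a n / (n : ℝ) ^ σ) :=
    tsum_nonneg fun n => by split_ifs; exacts [le_rfl, div_nonneg (ha n) (by positivity)]
  by_cases hu : 0 < u
  · rw [normSummatory_apply_of_pos hu]
    have h1 := summatory_le_rpow_mul_tsum ha (by linarith) hs (exp_pos u).le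
    rw [← Real.exp_mul] at h1
    calc (∑ n ∈ Icc 1 ⌊rexp u⌋₊, a n) * rexp (-u)
        ≤ rexp (u * σ) * (∑' n : ℕ, (if n = 0 then 0 else a n / (n : ℝ) ^ σ)) * rexp (-u) := by
          gcongr
      _ = (∑' n : ℕ, (if n = 0 then 0 else a n / (n : ℝ) ^ σ)) * rexp ((σ - 1) * u) := by
          rw [mul_comm (rexp _), mul_assoc, ← Real.exp_add]
          ring_nf
  · rw [normSummatory_apply_of_nonpos (not_lt.1 hu)]
    positivity

/-- Growth, integrated: `B e^{-ε·}` is integrable on `(0, ∞)` for every `ε > 0` when the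
Dirichlet series converges for `Re s > 1`. [folklore] -/
theorem integrableOn_normSummatory_mul_exp {a : ℕ → ℝ} (ha : ∀ n, 0 ≤ a n)
    (hsum : ∀ s : ℂ, 1 < s.re → LSeriesSummable (fun n => (a n : ℂ)) s) {ε : ℝ} (hε : 0 < ε) :
    IntegrableOn (fun u => (Ioi (0 : ℝ)).indicator
      (fun u => (∑ n ∈ Icc 1 ⌊rexp u⌋₊, a n) * rexp (-u)) u * rexp (-(ε * u))) (Ioi 0) := by
  set σ : ℝ := 1 + ε / 2 with hσ_def
  have hσ : 1 < σ := by rw [hσ_def]; linarith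
  have hs := summable_real_of_LSeriesSummable (hsum σ (by simpa using hσ))
  set S : ℝ := ∑' n : ℕ, (if n = 0 then 0 else a n / (n : ℝ) ^ σ)
  refine Integrable.mono' (((exp_neg_integrableOn_Ioi 0 (half_pos hε)).const_mul S)) ?_ ?_
  · exact ((measurable_normSummatory ha).mul (by fun_prop)).aestronglyMeasurable
  · filter_upwards with u
    rw [Real.norm_of_nonneg (mul_nonneg (normSummatory_nonneg ha u) (exp_pos _).le)]
    have h1 := normSummatory_le ha hσ hs u
    calc (Ioi (0 : ℝ)).indicator (fun u => (∑ n ∈ Icc 1 ⌊rexp u⌋₊, a n) * rexp (-u)) u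
          * rexp (-(ε * u))
        ≤ S * rexp ((σ - 1) * u) * rexp (-(ε * u)) := by gcongr
      _ = S * rexp (-(ε / 2) * u) := by
          rw [mul_assoc, ← Real.exp_add, hσ_def]
          ring_nf

/-! ## Dirichlet series as a Laplace transform of `B` -/

/-- **Mellin/Laplace representation** (`a_n ≥ 0`, series convergent for `Re s > 1`): for
`Re s > 1`, `∑ a_n n^{-s} = s ∫_0^∞ B(u) e^{-(s−1)u} du` — Mathlib's
`LSeries_eq_mul_integral_of_nonneg` (`= s ∫_1^∞ A(t) t^{-s-1} dt`) followed by `t = e^u`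
(Montgomery–Vaughan 2007, (1.24)/(8.2) and the change of variables between Cor. 8.7 and Thm. 8.6).
[cite: MontgomeryVaughan2007, §8.3, Cor. 8.7] -/
theorem LSeries_eq_mul_integral_normSummatory {a : ℕ → ℝ} (ha : ∀ n, 0 ≤ a n)
    (hsum : ∀ s : ℂ, 1 < s.re → LSeriesSummable (fun n => (a n : ℂ)) s) {s : ℂ} (hs : 1 < s.re) :
    LSeries (fun n => (a n : ℂ)) s = s * ∫ u in Ioi (0 : ℝ),
      (((Ioi (0 : ℝ)).indicator (fun u => (∑ n ∈ Icc 1 ⌊rexp u⌋₊, a n) * rexp (-u)) u : ℝ) : ℂ)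
        * Complex.exp (-(s - 1) * u) := by
  -- polynomial growth of the partial sums
  set σ : ℝ := 1 + (s.re - 1) / 2 with hσ_def
  have hσ : 1 < σ := by rw [hσ_def]; linarith
  have hσs : σ < s.re := by rw [hσ_def]; linarith
  have hsr := summable_real_of_LSeriesSummable (hsum σ (by simpa using hσ))
  set S : ℝ := ∑' n : ℕ, (if n = 0 then 0 else a n / (n : ℝ) ^ σ)
  have hO : (fun n : ℕ => ∑ k ∈ Icc 1 n, a k) =O[atTop] fun n : ℕ => (n : ℝ) ^ σ := by
    refine IsBigO.of_bound S (Eventually.of_forall fun n => ?_)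
    rw [Real.norm_of_nonneg (sum_nonneg fun k _ => ha k),
      Real.norm_of_nonneg (by positivity), mul_comm]
    simpa [Nat.floor_natCast] using
      summatory_le_rpow_mul_tsum ha (by linarith) hsr (Nat.cast_nonneg n)
  rw [LSeries_eq_mul_integral_of_nonneg a (by linarith) hσs hO ha]
  congr 1
  -- substitution `t = e^u`
  have hIoi : Ioi (1 : ℝ) = rexp '' Ioi 0 := by rw [Real.image_exp_Ioi, Real.exp_zero]
  rw [hIoi, integral_image_eq_integral_abs_deriv_smul measurableSet_Ioi
    (fun x _ => (Real.hasDerivAt_exp x).hasDerivWithinAt) Real.exp_injective.injOn]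
  refine setIntegral_congr_fun measurableSet_Ioi fun u (hu : 0 < u) => ?_
  rw [normSummatory_apply_of_pos hu, abs_of_pos (exp_pos u), Complex.real_smul,
    Complex.cpow_def_of_ne_zero (by exact_mod_cast (exp_pos u).ne'),
    ← Complex.ofReal_log (exp_pos u).le, Real.log_exp]
  push_cast
  have e1 : Complex.exp (u : ℂ) * Complex.exp ((u : ℂ) * -(s + 1))
      = Complex.exp (-(u : ℂ)) * Complex.exp (-(s - 1) * u) := by
    rw [← Complex.exp_add, ← Complex.exp_add]
    congr 1
    ring
  linear_combination (∑ k ∈ Icc 1 ⌊rexp u⌋₊, (a k : ℂ)) * e1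

end Literature.NumberTheory.LFunctions.WienerIkehara

namespace Literature.NumberTheory.LFunctions

open WienerIkehara in
/-- **Discharge of `Literature.NumberTheory.LFunctions.WienerIkehara` — the Wiener–Ikehara Tauberian theorem** (Montgomery–Vaughan
2007, Cor. 8.8): if `a_n ≥ 0`, `∑ a_n n^{-s}` converges for `Re s > 1`, and `∑ a_n n^{-s} − c/(s−1)`
agrees on `Re s > 1` with a function continuous on `Re s ≥ 1`, then `∑_{n ≤ N} a_n = cN + o(N)`.
Proof: classical Fejér-kernel argument (files `WienerIkeharaKernel`, `WienerIkeharaTauberian`,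
`WienerIkeharaLaplace`) applied to `B(u) = e^{-u} ∑_{n ≤ e^u} a_n` and `G(s) = (r(s) − c)/s`.
[cite: MontgomeryVaughan2007, Cor. 8.8] -/
theorem WienerIkehara_holds : WienerIkehara := by
  rintro a c ha hsum ⟨r, hr, hreq⟩
  set B : ℝ → ℝ := (Set.Ioi (0 : ℝ)).indicator
    (fun u => (∑ n ∈ Icc 1 ⌊rexp u⌋₊, a n) * rexp (-u)) with hB_def
  set G : ℂ → ℂ := fun s => (r s - c) / s with hG_def
  -- continuity of `G` on the closed half-plane
  have hGc : ContinuousOn G {s : ℂ | 1 ≤ s.re} := by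
    refine (hr.sub continuousOn_const).div continuousOn_id fun s hs h0 => ?_
    simp only [Set.mem_setOf_eq] at hs h0
    rw [h0] at hs
    simp only [Complex.zero_re] at hs
    linarith
  -- Laplace representation of `G` on the open half-plane
  have hGeq : ∀ s : ℂ, 1 < s.re →
      G s = ∫ u in Set.Ioi (0 : ℝ), ((B u - c : ℝ) : ℂ) * Complex.exp (-(s - 1) * u) := by
    intro s hs
    have hs0 : s ≠ 0 := fun h => by rw [h] at hs; simp at hs; linarith
    have hs1 : s - 1 ≠ 0 := fun h => by rw [sub_eq_zero] at h; rw [h] at hs; simp at hs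
    have hre : (-(s - 1)).re < 0 := by simp; linarith
    have hint1 : IntegrableOn (fun u : ℝ => ((B u : ℝ) : ℂ) * Complex.exp (-(s - 1) * u))
        (Set.Ioi 0) := by
      have hg := integrableOn_normSummatory_mul_exp ha hsum (ε := s.re - 1) (by linarith)
      refine Integrable.mono' hg ?_ ?_
      · exact ((Complex.measurable_ofReal.comp (measurable_normSummatory ha)).mul
          (by fun_prop)).aestronglyMeasurable
      · filter_upwards with u
        rw [norm_mul, Complex.norm_real, Real.norm_of_nonneg (normSummatory_nonneg ha u),
          Complex.norm_exp]
        refine le_of_eq ?_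
        congr 2
        simp only [neg_mul, Complex.neg_re, Complex.mul_re, Complex.sub_re, Complex.one_re,
          Complex.ofReal_re, Complex.sub_im, Complex.one_im, sub_zero, Complex.ofReal_im, mul_zero]
    have hint2 : IntegrableOn (fun u : ℝ => Complex.exp (-(s - 1) * u)) (Set.Ioi 0) :=
      integrableOn_exp_mul_complex_Ioi hre 0
    have h2 : ∫ u in Set.Ioi (0 : ℝ), Complex.exp (-(s - 1) * u) = 1 / (s - 1) := by
      rw [integral_exp_mul_complex_Ioi hre 0]
      simp only [Complex.ofReal_zero, mul_zero, Complex.exp_zero]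
      field_simp
    calc G s = (r s - c) / s := rfl
      _ = (LSeries (fun n => (a n : ℂ)) s) / s - c * (1 / (s - 1)) := by
          rw [hreq s hs]
          field_simp
          ring
      _ = (∫ u in Set.Ioi (0 : ℝ), ((B u : ℝ) : ℂ) * Complex.exp (-(s - 1) * u))
            - c * ∫ u in Set.Ioi (0 : ℝ), Complex.exp (-(s - 1) * u) := by
          rw [LSeries_eq_mul_integral_normSummatory ha hsum hs, h2, ← hB_def]
          field_simp
      _ = ∫ u in Set.Ioi (0 : ℝ), ((B u - c : ℝ) : ℂ) * Complex.exp (-(s - 1) * u) := by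
          rw [← MeasureTheory.integral_const_mul, ← integral_sub hint1 (hint2.const_mul _)]
          refine setIntegral_congr_fun measurableSet_Ioi fun u _ => ?_
          push_cast
          ring
  -- the Laplace-transform form of the theorem
  have hBlim : Tendsto B atTop (𝓝 c) :=
    tendsto_of_laplace c (measurable_normSummatory ha) (normSummatory_nonneg ha)
      (fun u hu => normSummatory_apply_of_nonpos hu) (normSummatory_slowly_decreasing ha)
      (fun ε hε => integrableOn_normSummatory_mul_exp ha hsum hε) hGc hGeq
  -- back to integers: `B(log N) = A(N)/N`
  have h1 : Tendsto (fun N : ℕ => B (Real.log N)) atTop (𝓝 c) :=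
    hBlim.comp (Real.tendsto_log_atTop.comp tendsto_natCast_atTop_atTop)
  have h2 : (fun N : ℕ => B (Real.log N)) =ᶠ[atTop] fun N : ℕ => (∑ n ∈ Icc 1 N, a n) / N := by
    filter_upwards [eventually_ge_atTop 2] with N hN
    have hN1 : (1 : ℝ) < N := by exact_mod_cast hN
    have hN : (0 : ℝ) < N := by linarith
    have hlog : 0 < Real.log N := Real.log_pos hN1
    rw [hB_def, normSummatory_apply_of_pos hlog, Real.exp_log hN, Nat.floor_natCast, Real.exp_neg,
      Real.exp_log hN, div_eq_mul_inv]
  have h3 : Tendsto (fun N : ℕ => (∑ n ∈ Icc 1 N, a n) / N - c) atTop (𝓝 0) := by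
    simpa using (h1.congr' h2).sub_const c
  refine (isLittleO_iff_tendsto' ?_).2 (h3.congr' ?_)
  · filter_upwards [eventually_ge_atTop 1] with N hN h
    have : (N : ℝ) ≠ 0 := by positivity
    exact absurd h this
  · filter_upwards [eventually_ge_atTop 1] with N hN
    have : (N : ℝ) ≠ 0 := by positivity
    field_simp

/-- **Discharge of the duplicate named fact `Literature.NumberTheory.LFunctions.MontgomeryVaughan2007_8_8`**
(`Literature.NumberTheory.LFunctions.Tauberian`), whose statement is verbatim that of
`Literature.NumberTheory.LFunctions.WienerIkehara` (Montgomery–Vaughan 2007, Cor. 8.8, integer form): the same proof term.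
[cite: MontgomeryVaughan2007, Cor. 8.8] -/
theorem MontgomeryVaughan2007_8_8_holds : LFunctions.MontgomeryVaughan2007_8_8 :=
  WienerIkehara_holds

end Literature.NumberTheory.LFunctions

end
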